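import Summits.HodgeConjecture.HodgeConjecture.Theorems.NikulinTwinTransportHodgeSimilitudeAlgebraicDivisorial
import Summits.HodgeConjecture.HodgeConjecture.Theorems.NikulinTwinTransportHodgeSimilitudeAlgebraicDirectSquarefree

/-!
# Route NikulinTwinTransport · crux `HodgeSimilitudeAlgebraic` (stmt-HodgeConjecture-13676) —
# THE TRANSCENDENTAL REDUCTION: twin transport on the transcendental classes suffices

The crux (every rational Hodge similitude of positive rational multiplier between `H²` of
projective K3 surfaces is algebraic) is, multiplier by multiplier, the lattice twin transport
`RatTwinTransportAt[c]` (seat 3's DIRECT characterisation, `…HodgeSimilitudeAlgebraicDirect`: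
`hodgeSimilitudeAlgebraic_iff_forall_ratTwinTransportAt`, modulo the marking fact and the Hodge
types of `H²(K3)`): for every rational `c`-similitude `M` of `Λ_{K3} ⊗ ℂ` and every `M`-twin pair of
marked projective K3 surfaces `(S, η)`, `(S′, η′)`, the twin similitude `ψ = η⁻¹ ∘ M ∘ η′` is
`[γ]_*` for an algebraic `γ`. This file proves that the transport need only be established ON THE
TRANSCENDENTAL CLASSES: it suffices that some algebraic `γ` induce `ψ` on
`T(S′) = {t | t ∪ d′ = 0 ∀ d′ ∈ N¹H²(S′)}` and carry `N¹H²(S′)` into `N¹H²(S)`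
(`TransTwinTransportFor[M]`) — as does, for instance, any class transported from the graph of a
rational quotient map `S′ ⇢ S′/σ`, which is a similitude on `T` but not on `NS` (Varesco 2023 §2;
van Geemen–Sarti 2007 §2 for Nikulin involutions). The Néron–Severi part comes for free: the error
`ψ − [γ]_*` kills `T(S′)` and is divisorial, hence `[γ_N]_*` for a combination `γ_N` of exterior
products of divisor classes (`exists_algebraic_of_divisorial`, file
`…HodgeSimilitudeAlgebraicDivisorial`; Huybrechts 2019 §1: "differ by divisor classes").

* `markingConj_mem_algebraicClasses` — `ψ = η⁻¹ ∘ M ∘ η′` carries `N¹H²(S′)` into `N¹H²(S)`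
  (rational span of `N¹`, `AlgebraicClassesOneOneK3`, `isRationalClass_markingConj`,
  `isOfHodgeType_markingConj`, `LefschetzOneOneK3`);
* `twinTransportFor_of_trans` — **`TransTwinTransportFor[M] → TwinTransportFor[M]`** for every
  rational similitude `M` of non-zero multiplier; `trans_of_twinTransportFor` — the converse;
  `ratTwinTransportAt_of_trans`, `ratTwinTransportAt_iff_trans` — per multiplier `c ≠ 0`,
  `RatTwinTransportAt[c] ↔ RatTransTwinTransportAt[c]`;
* `hodgeSimilitudeAlgebraic_of_forall_ratTransTwinTransportAt`, `…_iff_…` — **the crux from (and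
  iff) transcendental twin transport at every rational `c > 0`**;
  `hodgeSimilitudeAlgebraic_of_isometry_and_squarefree_trans` — from Buskin's item and
  transcendental twin transport at the squarefree `n ≥ 2`;
* `twinSimilitudeAlgebraic_of_ratTransTwinTransportAt_two`, `…_iff_…` — **the target X
  (stmt-HodgeConjecture-13674) from (and iff) transcendental twin transport at multiplier `2`**.

Granted throughout (hypotheses, nothing vendored): `Huybrechts_K3_marking_exists`,
`Huybrechts_K3_hodgeTypes_H2`, the Hodge index theorem `hodgeIndex_surface`, and the route items
`AlgebraicClassesOneOneK3` (stmt-HodgeConjecture-15041), `LefschetzOneOneK3`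
(stmt-HodgeConjecture-13678). No Buskin, no composition of correspondences / moving lemma, no period
surjectivity. No definitions, no `sorry`; axioms `propext`, `Classical.choice`, `Quot.sound`.
Prover seat prover-HodgeConjecture-route-HodgeConjecture-NikulinTwinTransport-3.

## References

* [Varesco2023] M. Varesco, Hodge similarities, algebraic classes, and Kuga–Satake varieties,
  Math. Z. 305 (2023), §2.
* [Huybrechts2019] D. Huybrechts, Motives of isogenous K3 surfaces, Comment. Math. Helv. 94 (2019), §1.
* [Buskin2019] N. Buskin, Every rational Hodge isometry between two K3 surfaces is algebraic,
  J. reine angew. Math. 755 (2019), Thm. 1.1 and §6.2.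
* [VanGeemenSarti2007] B. van Geemen, A. Sarti, Nikulin involutions on K3 surfaces, Math. Z. 255
  (2007), §2.
* [VoisinHodgeI2002] C. Voisin, Hodge Theory and Complex Algebraic Geometry I (2002), Thm. 11.30.
* [Huybrechts2016K3] D. Huybrechts, Lectures on K3 Surfaces (2016), Ch. 3 §2–3, Ch. 6 Prop. 1.2.
-/

noncomputable section

open CategoryTheory MonoidalCategory SemiCartesianMonoidalCategory
open scoped Manifold
open Literature.AlgebraicGeometry.Motives Literature.AlgebraicGeometry.HodgeTheory
open Literature.AlgebraicGeometry.Surfaces Literature.Geometry.Kaehler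
open Literature.AlgebraicTopology.SingularHomology
open Summit.HodgeConjecture.HodgeConjecture.Theses.NikulinTwinTransport

namespace Summit.HodgeConjecture.HodgeConjecture.Theorems.NikulinTwinTransport

/-! ### Local notations (verbatim those of the Direct / Frontier files, plus the transcendental variants) -/

/-- `MarkedK3[S, η, p, x]`: a marked K3 surface with period `x`. Local notation only. -/
local notation3 (prettyPrint := false) "MarkedK3[" S ", " η ", " p ", " x "]" =>
  (IsIntegralClass p ∧
    (∀ q : complexBetti S (2 * 2), IsIntegralClass q → ∃ n : ℤ, q = n • p) ∧
    (∀ c : complexBetti S (2 * 1), IsIntegralClass c ↔ ∃ v : K3Index → ℤ, η c = fun i => (v i : ℂ)) ∧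
    (∀ a b : complexBetti S (2 * 1),
        cupProduct (rfl : 2 * 1 + 2 * 1 = 2 * 2) a b = k3Form (η a) (η b) • p) ∧
    IsOfHodgeType 2 S (2 * 1) 2 0 (LinearEquiv.symm η x) ∧
    (∀ τ : complexBetti S (2 * 1), IsOfHodgeType 2 S (2 * 1) 2 0 τ → ∃ t : ℂ, τ = t • LinearEquiv.symm η x))

/-- `PeriodPt[x]`: a projective period point. Local notation only. -/
local notation3 (prettyPrint := false) "PeriodPt[" x "]" =>
  (k3Form x x = 0 ∧ 0 < (k3Form (star x) x).re ∧
    ∃ u : K3Index → ℤ, k3Form (fun i => (u i : ℂ)) x = 0 ∧ 0 < ∑ i, ∑ j, u i * k3Gram i j * u j)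

/-- `Corr[μ, S, S', hS, hS' ; γ, y] = [γ]_* y`. Local notation only. -/
local notation3 (prettyPrint := false) "Corr[" μ ", " S ", " S' ", " hS ", " hS' " ; " γ ", " y "]" =>
  complexGysin μ
    (IsSmoothProjective.tensor_holds (IsK3Surface.isSmoothProjective hS)
      (IsK3Surface.isSmoothProjective hS'))
    (IsK3Surface.isSmoothProjective hS) (SemiCartesianMonoidalCategory.fst S S')
    (rfl : 2 * 1 + 2 * 2 + 2 * 2 = 2 * 1 + 2 * (2 + 2))
    (cupProduct (rfl : 2 * 1 + 2 * 2 = 2 * 1 + 2 * 2)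
      (complexBetti.map (SemiCartesianMonoidalCategory.snd S S') (2 * 1) y) γ)

/-- `TwinTransportFor[M]`: the twin transport for the endomorphism `M` of `Λ_ℂ`. Local notation only,
verbatim from the Direct / Frontier files. -/
local notation3 (prettyPrint := false) "TwinTransportFor[" M "]" =>
  ∀ (μ : OrientationFamily), μ.HasPoincareDuality →
    ∀ (S S' : SchemeOver ℂ) (hS : IsK3Surface S) (hS' : IsK3Surface S')
      (η : complexBetti S (2 * 1) ≃ₗ[ℂ] (K3Index → ℂ)) (p : complexBetti S (2 * 2))
      (x : K3Index → ℂ)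
      (η' : complexBetti S' (2 * 1) ≃ₗ[ℂ] (K3Index → ℂ)) (p' : complexBetti S' (2 * 2))
      (x' : K3Index → ℂ),
      MarkedK3[S, η, p, x] → PeriodPt[x] → MarkedK3[S', η', p', x'] → PeriodPt[x'] →
      (∃ t : ℂ, M x' = t • x) →
      ∃ γ ∈ algebraicClasses (MonoidalCategoryStruct.tensorObj S S') 2,
        ∀ y : complexBetti S' (2 * 1), η.symm (M (η' y)) = Corr[μ, S, S', hS, hS' ; γ, y]

/-- `TransTwinTransportFor[M]`: the TRANSCENDENTAL twin transport for `M` — on every `M`-twin pair of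
marked projective K3 surfaces some algebraic class induces `η⁻¹ ∘ M ∘ η′` on the transcendental
classes `T(S′) = (N¹H²(S′))^⊥` and carries `N¹H²(S′)` into `N¹H²(S)`. Local notation only. -/
local notation3 (prettyPrint := false) "TransTwinTransportFor[" M "]" =>
  ∀ (μ : OrientationFamily), μ.HasPoincareDuality →
    ∀ (S S' : SchemeOver ℂ) (hS : IsK3Surface S) (hS' : IsK3Surface S')
      (η : complexBetti S (2 * 1) ≃ₗ[ℂ] (K3Index → ℂ)) (p : complexBetti S (2 * 2))
      (x : K3Index → ℂ)
      (η' : complexBetti S' (2 * 1) ≃ₗ[ℂ] (K3Index → ℂ)) (p' : complexBetti S' (2 * 2))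
      (x' : K3Index → ℂ),
      MarkedK3[S, η, p, x] → PeriodPt[x] → MarkedK3[S', η', p', x'] → PeriodPt[x'] →
      (∃ t : ℂ, M x' = t • x) →
      ∃ γ ∈ algebraicClasses (MonoidalCategoryStruct.tensorObj S S') 2,
        (∀ d' ∈ algebraicClasses S' 1, Corr[μ, S, S', hS, hS' ; γ, d'] ∈ algebraicClasses S 1) ∧
        ∀ y : complexBetti S' (2 * 1),
          (∀ d' ∈ algebraicClasses S' 1, cupProduct (rfl : 2 * 1 + 2 * 1 = 2 * 2) y d' = 0) →
          η.symm (M (η' y)) = Corr[μ, S, S', hS, hS' ; γ, y]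

/-- `RatTwinTransportAt[c]`: twin transport for every rational `c`-similitude of `Λ_ℂ` with rational
two-sided inverse. Local notation only, verbatim from the Direct / Frontier files. -/
local notation3 (prettyPrint := false) "RatTwinTransportAt[" c "]" =>
  ∀ (M N : Module.End ℂ (K3Index → ℂ)),
    (∀ v : K3Index → ℤ, ∃ w : K3Index → ℚ, M (fun i => (v i : ℂ)) = fun i => (w i : ℂ)) →
    (∀ v : K3Index → ℤ, ∃ w : K3Index → ℚ, N (fun i => (v i : ℂ)) = fun i => (w i : ℂ)) →
    M * N = 1 → N * M = 1 → (∀ a b, k3Form (M a) (M b) = c * k3Form a b) → TwinTransportFor[M]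

/-- `RatTransTwinTransportAt[c]`: TRANSCENDENTAL twin transport for every rational `c`-similitude of
`Λ_ℂ` with rational two-sided inverse. Local notation only. -/
local notation3 (prettyPrint := false) "RatTransTwinTransportAt[" c "]" =>
  ∀ (M N : Module.End ℂ (K3Index → ℂ)),
    (∀ v : K3Index → ℤ, ∃ w : K3Index → ℚ, M (fun i => (v i : ℂ)) = fun i => (w i : ℂ)) →
    (∀ v : K3Index → ℤ, ∃ w : K3Index → ℚ, N (fun i => (v i : ℂ)) = fun i => (w i : ℂ)) →
    M * N = 1 → N * M = 1 → (∀ a b, k3Form (M a) (M b) = c * k3Form a b) → TransTwinTransportFor[M]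

/-- **A rational similitude carrying periods to periods maps Néron–Severi classes to Néron–Severi
classes.** For marked projective K3 surfaces `(S, η, p, x)`, `(S′, η′, p′, x′)` and a rational
similitude `M` of `Λ_ℂ` of non-zero multiplier with `M x′ ∈ ℂ x`, the map `η⁻¹ ∘ M ∘ η′` carries
`N¹H²(S′)` into `N¹H²(S)`: `N¹H²(S′)` is spanned by its rational classes, which are of type `(1,1)`
(`AlgebraicClassesOneOneK3`), their images are rational (`isRationalClass_markingConj`) of type
`(1,1)` (`isOfHodgeType_markingConj`), hence algebraic by Lefschetz `(1,1)` (`LefschetzOneOneK3`).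
[cite: VoisinHodgeI2002, Thm. 11.30] [cite: Huybrechts2016K3, Ch. 6 Prop. 1.2] -/
theorem markingConj_mem_algebraicClasses (hHT : Huybrechts_K3_hodgeTypes_H2)
    (hN11 : AlgebraicClassesOneOneK3) (hL11 : LefschetzOneOneK3)
    {S S' : SchemeOver ℂ} (hS : IsK3Surface S) (hS' : IsK3Surface S')
    {η : complexBetti S (2 * 1) ≃ₗ[ℂ] (K3Index → ℂ)} {p : complexBetti S (2 * 2)} {x : K3Index → ℂ}
    {η' : complexBetti S' (2 * 1) ≃ₗ[ℂ] (K3Index → ℂ)} {p' : complexBetti S' (2 * 2)}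
    {x' : K3Index → ℂ}
    (hm : MarkedK3[S, η, p, x]) (hx : PeriodPt[x]) (hm' : MarkedK3[S', η', p', x']) (hx' : PeriodPt[x'])
    (M : Module.End ℂ (K3Index → ℂ))
    (hMrat : ∀ v : K3Index → ℤ, ∃ w : K3Index → ℚ, M (fun i => (v i : ℂ)) = fun i => (w i : ℂ))
    {c : ℂ} (hc : c ≠ 0) (hM : ∀ a b, k3Form (M a) (M b) = c * k3Form a b)
    (hper : ∃ t : ℂ, M x' = t • x) {d' : complexBetti S' (2 * 1)}
    (hd' : d' ∈ algebraicClasses S' 1) : η.symm (M (η' d')) ∈ algebraicClasses S 1 := by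
  have hp'0 : p' ≠ 0 := generator_ne_zero hS' hm'.2.1
  have htyp := isOfHodgeType_markingConj η p x η' p' x' M hHT hS hS' hm.2.2.1 hm.2.2.2.1
    hm.2.2.2.2.1 hx.2.1 hm'.2.2.1 hm'.2.2.2.1 hp'0 hm'.2.2.2.2.1 hx'.2.1 hMrat hc hM hper
  have hspan := span_isRationalClass_eq_top_of_isSmoothProjective_holds.supportedClasses_eq_span
    hS'.isSmoothProjective (2 * 1) 1
  have hd : d' ∈ Submodule.span ℂ {c : complexBetti S' (2 * 1) |
      IsRationalClass c ∧ c ∈ supportedClasses S' (2 * 1) 1} := by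
    rw [← hspan]; exact hd'
  clear hd'
  induction hd using Submodule.span_induction with
  | mem c hc' =>
    exact hL11 S hS _ (isRationalClass_markingConj η η' M hS hS' hm.2.2.1 hm'.2.2.1 hMrat hc'.1)
      (htyp 1 1 c (hN11 S' hS' c hc'.2))
  | zero => rw [map_zero, map_zero, map_zero]; exact Submodule.zero_mem _
  | add c c' _ _ hc hc' => rw [map_add, map_add, map_add]; exact Submodule.add_mem _ hc hc'
  | smul t c _ hc => rw [map_smul, map_smul, map_smul]; exact Submodule.smul_mem _ _ hc

/-- **TRANSCENDENTAL TWIN TRANSPORT SUFFICES.** For a rational similitude `M` of `Λ_ℂ` of non-zero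
multiplier: if on every `M`-twin pair of marked projective K3 surfaces some algebraic class induces
`ψ = η⁻¹ ∘ M ∘ η′` on the transcendental classes `T(S′)` and carries `N¹H²(S′)` into `N¹H²(S)`
(`TransTwinTransportFor[M]`), then on every such pair some algebraic class induces `ψ` on all of
`H²(S′(ℂ); ℂ)` (`TwinTransportFor[M]`). Proof: with `γ_T` the given class, the error
`E = ψ − [γ_T]_*` kills `T(S′)` and carries `N¹H²(S′)` into `N¹H²(S)` (`ψ` does,
`markingConj_mem_algebraicClasses`), so `E = [γ_N]_*` for an algebraic `γ_N`
(`exists_algebraic_of_divisorial`), and `ψ = [γ_T + γ_N]_*`. Granted: the Hodge types of `H²(K3)`,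
the Hodge index theorem, and the route items `AlgebraicClassesOneOneK3`, `LefschetzOneOneK3`.
[cite: Huybrechts2019, §1] [cite: Varesco2023, §2] [cite: Buskin2019, §6.2] -/
theorem twinTransportFor_of_trans (hHT : Huybrechts_K3_hodgeTypes_H2)
    (hHI : ∀ X : SchemeOver ℂ, hodgeIndex_surface X)
    (hN11 : AlgebraicClassesOneOneK3) (hL11 : LefschetzOneOneK3)
    (M : Module.End ℂ (K3Index → ℂ))
    (hMrat : ∀ v : K3Index → ℤ, ∃ w : K3Index → ℚ, M (fun i => (v i : ℂ)) = fun i => (w i : ℂ))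
    {c : ℂ} (hc : c ≠ 0) (hM : ∀ a b, k3Form (M a) (M b) = c * k3Form a b)
    (htr : TransTwinTransportFor[M]) : TwinTransportFor[M] := by
  intro μ hμ S S' hS hS' η p x η' p' x' hm hx hm' hx' hper
  have hp'0 : p' ≠ 0 := generator_ne_zero hS' hm'.2.1
  obtain ⟨γ₀, hγ₀, hγ₀N, hγ₀T⟩ := htr μ hμ S S' hS hS' η p x η' p' x' hm hx hm' hx' hper
  -- `ψ = η⁻¹ ∘ M ∘ η'` and `[γ₀]_*` as linear maps
  let ψ : complexBetti S' (2 * 1) →ₗ[ℂ] complexBetti S (2 * 1) :=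
    η.symm.toLinearMap ∘ₗ M ∘ₗ η'.toLinearMap
  have hψ : ∀ y, ψ y = η.symm (M (η' y)) := fun y ↦ rfl
  let C : complexBetti S' (2 * 1) →ₗ[ℂ] complexBetti S (2 * 1) :=
    (complexGysin μ
        (IsSmoothProjective.tensor_holds (IsK3Surface.isSmoothProjective hS)
          (IsK3Surface.isSmoothProjective hS'))
        (IsK3Surface.isSmoothProjective hS) (SemiCartesianMonoidalCategory.fst S S')
        (rfl : 2 * 1 + 2 * 2 + 2 * 2 = 2 * 1 + 2 * (2 + 2))) ∘ₗ
      ((cupProduct (rfl : 2 * 1 + 2 * 2 = 2 * 1 + 2 * 2)).flip γ₀) ∘ₗ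
      (complexBetti.map (SemiCartesianMonoidalCategory.snd S S') (2 * 1)).hom
  have hC : ∀ y, C y = Corr[μ, S, S', hS, hS' ; γ₀, y] := fun y ↦ rfl
  -- the error `E = ψ - [γ₀]_*` is divisorial
  have hET : ∀ t, (∀ d' ∈ algebraicClasses S' 1,
      cupProduct (rfl : 2 * 1 + 2 * 1 = 2 * 2) t d' = 0) → (ψ - C) t = 0 := fun t ht ↦ by
    rw [LinearMap.sub_apply, hψ, hC, hγ₀T t ht, sub_self]
  have hEN : ∀ d' ∈ algebraicClasses S' 1, (ψ - C) d' ∈ algebraicClasses S 1 := fun d' hd' ↦ by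
    rw [LinearMap.sub_apply, hψ, hC]
    exact Submodule.sub_mem _ (markingConj_mem_algebraicClasses hHT hN11 hL11 hS hS' hm hx hm' hx'
      M hMrat hc hM hper hd') (hγ₀N d' hd')
  obtain ⟨γ₁, hγ₁, hγ₁act⟩ := exists_algebraic_of_divisorial μ hμ hS hS' η' hp'0 hm'.2.2.1
    hm'.2.2.2.1 (hHI S') (ψ - C) hET hEN
  refine ⟨γ₀ + γ₁, Submodule.add_mem _ hγ₀ hγ₁, fun y ↦ ?_⟩
  rw [corr_add μ hS.isSmoothProjective hS'.isSmoothProjective, ← hC, ← hγ₁act y,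
    LinearMap.sub_apply, hψ, add_sub_cancel]


/-- **Conversely, the full twin transport gives the transcendental one** (the class inducing `ψ`
on all of `H²(S′)` carries `N¹H²(S′)` into `N¹H²(S)` because `ψ` does,
`markingConj_mem_algebraicClasses`). [cite: Buskin2019, §6.2] -/
theorem trans_of_twinTransportFor (hHT : Huybrechts_K3_hodgeTypes_H2)
    (hN11 : AlgebraicClassesOneOneK3) (hL11 : LefschetzOneOneK3)
    (M : Module.End ℂ (K3Index → ℂ))
    (hMrat : ∀ v : K3Index → ℤ, ∃ w : K3Index → ℚ, M (fun i => (v i : ℂ)) = fun i => (w i : ℂ))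
    {c : ℂ} (hc : c ≠ 0) (hM : ∀ a b, k3Form (M a) (M b) = c * k3Form a b)
    (htw : TwinTransportFor[M]) : TransTwinTransportFor[M] := by
  intro μ hμ S S' hS hS' η p x η' p' x' hm hx hm' hx' hper
  obtain ⟨γ, hγ, hγeq⟩ := htw μ hμ S S' hS hS' η p x η' p' x' hm hx hm' hx' hper
  refine ⟨γ, hγ, fun d' hd' ↦ ?_, fun y _ ↦ hγeq y⟩
  rw [← hγeq d']
  exact markingConj_mem_algebraicClasses hHT hN11 hL11 hS hS' hm hx hm' hx' M hMrat hc hM hper hd'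

/-- **Twin transport at multiplier `c ≠ 0` from TRANSCENDENTAL twin transport at multiplier `c`**
(`twinTransportFor_of_trans` for every rational `c`-similitude with rational two-sided inverse).
[cite: Huybrechts2019, §1] [cite: Varesco2023, §2] -/
theorem ratTwinTransportAt_of_trans (hHT : Huybrechts_K3_hodgeTypes_H2)
    (hHI : ∀ X : SchemeOver ℂ, hodgeIndex_surface X)
    (hN11 : AlgebraicClassesOneOneK3) (hL11 : LefschetzOneOneK3) (c : ℂ) (hc : c ≠ 0)
    (h : RatTransTwinTransportAt[c]) : RatTwinTransportAt[c] :=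
  fun M N hMrat hNrat hMN hNM hM ↦
    twinTransportFor_of_trans hHT hHI hN11 hL11 M hMrat hc hM (h M N hMrat hNrat hMN hNM hM)

/-- **Twin transport ⟺ transcendental twin transport**, multiplier by multiplier (`c ≠ 0`), modulo
the Hodge types of `H²(K3)`, the Hodge index theorem and the two route items on `(1,1)`-classes.
[cite: Huybrechts2019, §1] [cite: Varesco2023, §2] -/
theorem ratTwinTransportAt_iff_trans (hHT : Huybrechts_K3_hodgeTypes_H2)
    (hHI : ∀ X : SchemeOver ℂ, hodgeIndex_surface X)
    (hN11 : AlgebraicClassesOneOneK3) (hL11 : LefschetzOneOneK3) (c : ℂ) (hc : c ≠ 0) :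
    RatTwinTransportAt[c] ↔ RatTransTwinTransportAt[c] :=
  ⟨fun h M N hMrat hNrat hMN hNM hM ↦
      trans_of_twinTransportFor hHT hN11 hL11 M hMrat hc hM (h M N hMrat hNrat hMN hNM hM),
    ratTwinTransportAt_of_trans hHT hHI hN11 hL11 c hc⟩

/-! ### The crux and the target X from transcendental twin transport -/

/-- **THE CRUX FROM TRANSCENDENTAL TWIN TRANSPORT.** `HodgeSimilitudeAlgebraic` holds as soon as,
for every rational `c > 0` and every rational `c`-similitude `M` of the K3 lattice (with rational
two-sided inverse), on every `M`-twin pair of marked projective K3 surfaces some algebraic class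
induces `η⁻¹ ∘ M ∘ η′` ON THE TRANSCENDENTAL CLASSES and carries divisor classes to divisor classes
— granted the marking fact, the Hodge types of `H²(K3)`, the Hodge index theorem and the route items
`AlgebraicClassesOneOneK3` (stmt-HodgeConjecture-15041), `LefschetzOneOneK3`
(stmt-HodgeConjecture-13678). No Buskin, no composition of correspondences, no period surjectivity
(`hodgeSimilitudeAlgebraic_of_forall_ratTwinTransportAt`). [cite: Varesco2023, §2]
[cite: Huybrechts2019, §1] [cite: Buskin2019, §6.2] -/
theorem hodgeSimilitudeAlgebraic_of_forall_ratTransTwinTransportAt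
    (hMk : Huybrechts_K3_marking_exists) (hHT : Huybrechts_K3_hodgeTypes_H2)
    (hHI : ∀ X : SchemeOver ℂ, hodgeIndex_surface X)
    (hN11 : AlgebraicClassesOneOneK3) (hL11 : LefschetzOneOneK3)
    (h : ∀ c : ℚ, 0 < c → RatTransTwinTransportAt[((c : ℚ) : ℂ)]) : HodgeSimilitudeAlgebraic :=
  hodgeSimilitudeAlgebraic_of_forall_ratTwinTransportAt hMk fun c hc ↦
    ratTwinTransportAt_of_trans hHT hHI hN11 hL11 (c : ℂ) (by exact_mod_cast hc.ne') (h c hc)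

/-- **THE CRUX ⟺ TRANSCENDENTAL TWIN TRANSPORT AT EVERY POSITIVE RATIONAL MULTIPLIER**, modulo
the standard facts and the two route items on `(1,1)`-classes. [cite: Varesco2023, §2]
[cite: Huybrechts2019, §1] -/
theorem hodgeSimilitudeAlgebraic_iff_forall_ratTransTwinTransportAt
    (hMk : Huybrechts_K3_marking_exists) (hHT : Huybrechts_K3_hodgeTypes_H2)
    (hHI : ∀ X : SchemeOver ℂ, hodgeIndex_surface X)
    (hN11 : AlgebraicClassesOneOneK3) (hL11 : LefschetzOneOneK3) :
    HodgeSimilitudeAlgebraic ↔ ∀ c : ℚ, 0 < c → RatTransTwinTransportAt[((c : ℚ) : ℂ)] := by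
  refine ⟨fun hX c hc ↦ ?_, hodgeSimilitudeAlgebraic_of_forall_ratTransTwinTransportAt hMk hHT hHI hN11 hL11⟩
  exact (ratTwinTransportAt_iff_trans hHT hHI hN11 hL11 (c : ℂ) (by exact_mod_cast hc.ne')).1
    ((hodgeSimilitudeAlgebraic_iff_forall_ratTwinTransportAt hMk hHT).1 hX c hc)

/-- **Squarefree integer multipliers suffice, transcendentally**: the crux from Buskin's item
(`HodgeIsometryAlgebraic`, stmt-HodgeConjecture-13675) and transcendental twin transport at every
squarefree `n ≥ 2` (`hodgeSimilitudeAlgebraic_of_squarefree_ratTwinTransportAt`).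
[cite: Buskin2019, Thm. 1.1] [cite: Varesco2023, §2] -/
theorem hodgeSimilitudeAlgebraic_of_isometry_and_squarefree_trans
    (hMk : Huybrechts_K3_marking_exists) (hHT : Huybrechts_K3_hodgeTypes_H2)
    (hHI : ∀ X : SchemeOver ℂ, hodgeIndex_surface X)
    (hN11 : AlgebraicClassesOneOneK3) (hL11 : LefschetzOneOneK3) (hB : HodgeIsometryAlgebraic)
    (h : ∀ n : ℕ, 2 ≤ n → Squarefree n → RatTransTwinTransportAt[((n : ℕ) : ℂ)]) :
    HodgeSimilitudeAlgebraic :=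
  (hodgeSimilitudeAlgebraic_iff_isometry_and_squarefree hMk hHT).2 ⟨hB, fun n hn hsq ↦
    ratTwinTransportAt_of_trans hHT hHI hN11 hL11 (n : ℂ) (by exact_mod_cast (show n ≠ 0 by omega))
      (h n hn hsq)⟩

/-- **THE TARGET X (`TwinSimilitudeAlgebraic`, stmt-HodgeConjecture-13674) FROM TRANSCENDENTAL TWIN
TRANSPORT AT MULTIPLIER `2`**: a line for X may deliver, on each twin pair of a rational
`2`-similitude of `Λ_{K3}`, an algebraic class inducing the twin similitude on the transcendental
classes only (and carrying divisors to divisor classes) — e.g. the transport of a Nikulin quotient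
correspondence, which is a `2`-similitude on `T` but not on `NS`. [cite: Varesco2023, §2]
[cite: VanGeemenSarti2007, §2] -/
theorem twinSimilitudeAlgebraic_of_ratTransTwinTransportAt_two
    (hMk : Huybrechts_K3_marking_exists) (hHT : Huybrechts_K3_hodgeTypes_H2)
    (hHI : ∀ X : SchemeOver ℂ, hodgeIndex_surface X)
    (hN11 : AlgebraicClassesOneOneK3) (hL11 : LefschetzOneOneK3)
    (h : RatTransTwinTransportAt[(2 : ℂ)]) : TwinSimilitudeAlgebraic :=
  twinSimilitudeAlgebraic_of_ratTwinTransportAt_two hMk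
    (ratTwinTransportAt_of_trans hHT hHI hN11 hL11 2 two_ne_zero h)

/-- **X ⟺ transcendental twin transport at multiplier `2`**, modulo the standard facts and the two
route items on `(1,1)`-classes. [cite: Varesco2023, §2] -/
theorem twinSimilitudeAlgebraic_iff_ratTransTwinTransportAt_two
    (hMk : Huybrechts_K3_marking_exists) (hHT : Huybrechts_K3_hodgeTypes_H2)
    (hHI : ∀ X : SchemeOver ℂ, hodgeIndex_surface X)
    (hN11 : AlgebraicClassesOneOneK3) (hL11 : LefschetzOneOneK3) :
    TwinSimilitudeAlgebraic ↔ RatTransTwinTransportAt[(2 : ℂ)] :=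
  (twinSimilitudeAlgebraic_iff_ratTwinTransportAt_two hMk hHT).trans
    (ratTwinTransportAt_iff_trans hHT hHI hN11 hL11 2 two_ne_zero)


end Summit.HodgeConjecture.HodgeConjecture.Theorems.NikulinTwinTransport

end
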